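import Summits.QuantumFields.YangMills.Theorems.SwapVirialDeficitZeroModeExactAxialTube
import Summits.QuantumFields.YangMills.Theorems.SwapVirialDeficitZeroModeGroupThreeAxis
import Summits.QuantumFields.YangMills.Theorems.ToronValleyVolumeNearlyCommutingCeilingSection
import HarnessLib

/-!
# Zero-mode EXACT rung Z1-b: the one-letter commutator ball has Haar mass EXACTLY `min 1 (t²/(4(1 − re(q a)²)))`
# (free-hands support of crux ⟨stmt-QuantumFields-24197⟩ `SwapVirialDeficit.SwapGluedStiffness`; item Z1 of fcl-p3 g43's zero-mode exact rung plan
# `memo-24197-zero-mode-exact-rung.md`, evidence #10 on ⟨24197⟩)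

★★★ `haar_commBall_eq`: for `a ∈ SU(2)` with `re(q a)² < 1` (i.e. `a ≠ ±1`) and `t ≥ 0`,
  `Haar{u ∈ SU(2) | ‖q a·q u − q u·q a‖ ≤ t} = min 1 (t² / (4·(1 − re(q a)²)))`   (`q = su2Quat`).
So for every non-central letter the commutator ball is an EXACT quadratic law `t²/(4‖Im q a‖²)` up to saturation — the one-letter fibre volume of
every exact zero-mode constant (Z3 `v₂`, Z4 `v₃`, Z5 `v₇` of the plan).
Proof: `‖[z,w]‖² = 4|Im z × Im w|²`; a unit `c` straightens `q a` onto the `i`-axis (✓`NearlyCommutingCeiling.exists_unit_straighten`), after which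
`‖[q a, x̂]‖² = 4‖Im q a‖²·(y_J² + y_K²)/‖y‖²`, `y = c̄ x c` (✓`norm_comm_sq_axisPoint`); in the cone model of Haar (✓`ToronLog.measurePreserving_quatToSU2`)
conjugation is measure preserving (✓`ZeroModeGroup.measurePreserving_conjIso_cone`, w2 g55), so the ball has the Haar mass of the axial tube of radius
`R = t/(2‖Im q a‖)`, which is `min 1 R²` by file Z1-a ✓`haar_axialTube_eq_ofReal` (Archimedes on `S³`); `‖Im q a‖² = 1 − re(q a)²`.

HONEST LABEL: an exact finite-dimensional Haar-measure identity (plan-level zero-mode rung Z1 of a DRAFT line); NOT the fixed-`L` sharp law, NOT ⟨24197⟩;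
no rung / summit statement is proved; the Yang–Mills mass gap is NOT proved; no summit is proved by a line.  Width seat ym-line-sfw-p2-w3 g62 (cell
ym-idea-1, free hands; own crux ⟨22884⟩ blocked-on ⟨19935⟩), `--supports stmt-QuantumFields-24197`.  THEOREMS ONLY, standard axioms, 0 `sorry`.
References: [cite: Chatterjee2026YMHiggs, Lemma 5.1 / Cor. 5.2]; [folklore].
-/

set_option autoImplicit false

noncomputable section

open MeasureTheory Quaternion Set Real
open scoped Quaternion ENNReal BigOperators
open Literature.MathematicalPhysics.QuantumLattice
open Literature.MathematicalPhysics.QuantumFieldTheory (haarProbability)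
open Literature.MathematicalPhysics.QuantumFieldTheory.Balaban1983to89.T4HaarSU2Translate (su2Quat_quatToSU2 measurable_su2Quat
  continuous_su2Quat)
open Summit.QuantumFields.YangMills.Theorems.SwapTwistDeficit.ToronLog
open Summit.QuantumFields.YangMills.Theorems.SwapVirialDeficit.ZeroModeGroup (measurePreserving_conjIso_cone coneMeasure_singleton_zero)
open Summit.QuantumFields.YangMills.Theorems.ToronValleyVolume.NearlyCommutingCeiling (exists_unit_straighten norm_comm_sq_axisPoint
  norm_comm_sq_star_axisPoint sq_norm_im_eq)

attribute [local instance] Literature.Analysis.FluidPDE.Tao2016.quatMeasurableSpace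
  Literature.Analysis.FluidPDE.Tao2016.quatBorelSpace
  Literature.MathematicalPhysics.QuantumLattice.secondCountableTopology_su2

namespace Summit.QuantumFields.YangMills.Theorems.SwapVirialDeficit.ZeroModeExact

/-! ## §5 The cone model: Haar mass = cone measure of the radial preimage; the radial point `0` is null -/

/-- Haar mass of a measurable set of `SU(2)` = cone measure of its radial preimage. [folklore] -/
theorem haar_eq_cone_preimage {S : Set (Matrix.specialUnitaryGroup (Fin 2) ℂ)} (hS : MeasurableSet S) :
    haarProbability (Matrix.specialUnitaryGroup (Fin 2) ℂ) S = coneMeasure (quatToSU2 ⁻¹' S) :=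
  (measurePreserving_quatToSU2.measure_preimage hS.nullMeasurableSet).symm

/-- Almost every point of the cone is non-zero. [folklore] -/
theorem ae_ne_zero_cone : ∀ᵐ x : ℍ ∂coneMeasure, x ≠ 0 := by
  refine ae_iff.2 ?_
  simpa using coneMeasure_singleton_zero

/-! ## §6 Commutator algebra: radial projection and unit conjugation -/

/-- In the cone model (`x ≠ 0`): `‖z·q(Px) − q(Px)·z‖ = ‖x‖⁻¹·‖z x − x z‖`. [folklore] -/
theorem norm_comm_proj {x : ℍ} (hx : x ≠ 0) (z : ℍ) :
    ‖z * su2Quat (quatToSU2 x) - su2Quat (quatToSU2 x) * z‖ = ‖x‖⁻¹ * ‖z * x - x * z‖ := by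
  rw [su2Quat_quatToSU2 hx, mul_smul_comm, smul_mul_assoc, ← smul_sub, norm_smul, norm_inv, norm_norm]

/-- Conjugating both letters by a UNIT quaternion keeps `‖z x − x z‖`. [folklore] -/
theorem norm_comm_conj_unit {c : ℍ} (hc : ‖c‖ = 1) (z x : ℍ) :
    ‖z * x - x * z‖ = ‖(star c * z * c) * (star c * x * c) - (star c * x * c) * (star c * z * c)‖ := by
  have hc0 : c ≠ 0 := by
    intro h; rw [h, norm_zero] at hc; exact zero_ne_one hc
  have hN : normSq c = 1 := by rw [Quaternion.normSq_eq_norm_mul_self, hc, mul_one]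
  have h := norm_comm_eq_of_conj hc0 z x
  simpa only [hN, inv_one, one_smul] using h

/-- After straightening: `‖q a·x − x·q a‖² = 4‖Im q a‖²·((c̄xc)_J² + (c̄xc)_K²)`. [folklore] -/
theorem norm_comm_sq_straighten {z c : ℍ} (hc : ‖c‖ = 1)
    (hstr : star c * z * c = axisPoint z ∨ star c * z * c = star (axisPoint z)) (x : ℍ) :
    ‖z * x - x * z‖ ^ 2 = 4 * ‖z.im‖ ^ 2 * ((star c * x * c).imJ ^ 2 + (star c * x * c).imK ^ 2) := by
  rw [norm_comm_conj_unit hc z x]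
  rcases hstr with h | h
  · rw [h]; exact norm_comm_sq_axisPoint z _
  · rw [h]; exact norm_comm_sq_star_axisPoint z _

/-- ★ POINTWISE (`x ≠ 0`): `x̂` is in the commutator ball of `q a` iff `c̄ x c` projects into the axial tube of radius `t/(2‖Im q a‖)`. [folklore] -/
theorem mem_commBall_iff {z c : ℍ} (hc : ‖c‖ = 1)
    (hstr : star c * z * c = axisPoint z ∨ star c * z * c = star (axisPoint z)) (hs : 0 < ‖z.im‖) {t : ℝ} (ht : 0 ≤ t)
    {x : ℍ} (hx : x ≠ 0) :
    ‖z * su2Quat (quatToSU2 x) - su2Quat (quatToSU2 x) * z‖ ≤ t ↔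
      (su2Quat (quatToSU2 (conjIso c hc x))).imJ ^ 2 + (su2Quat (quatToSU2 (conjIso c hc x))).imK ^ 2 ≤
        (t / (2 * ‖z.im‖)) ^ 2 := by
  have hy0 : conjIso c hc x ≠ 0 := by
    intro h
    have : ‖conjIso c hc x‖ = 0 := by rw [h, norm_zero]
    rw [LinearIsometryEquiv.norm_map] at this
    exact hx (norm_eq_zero.1 this)
  have hxn : 0 < ‖x‖ := norm_pos_iff.2 hx
  rw [tube_coord hy0, LinearIsometryEquiv.norm_map, conjIso_apply, norm_comm_proj hx]
  have hsq := norm_comm_sq_straighten hc hstr x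
  have hJK : 0 ≤ (star c * x * c).imJ ^ 2 + (star c * x * c).imK ^ 2 := by positivity
  rw [div_le_iff₀ (by positivity), div_pow, mul_pow, show (2 : ℝ) ^ 2 * ‖z.im‖ ^ 2 = 4 * ‖z.im‖ ^ 2 by norm_num,
    div_mul_eq_mul_div, le_div_iff₀ (by positivity)]
  -- `‖x‖⁻¹·N ≤ t ↔ N² ≤ t²‖x‖²` with `N² = 4s²·(J²+K²)`
  constructor
  · intro h
    have h1 : ‖z * x - x * z‖ ≤ t * ‖x‖ := by
      rw [inv_mul_le_iff₀ hxn] at h; linarith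
    have h2 : ‖z * x - x * z‖ ^ 2 ≤ (t * ‖x‖) ^ 2 := pow_le_pow_left₀ (norm_nonneg _) h1 2
    nlinarith [h2, hsq]
  · intro h
    rw [inv_mul_le_iff₀ hxn, mul_comm]
    have h2 : ‖z * x - x * z‖ ^ 2 ≤ (t * ‖x‖) ^ 2 := by nlinarith [h, hsq]
    exact (pow_le_pow_iff_left₀ (norm_nonneg _) (mul_nonneg ht hxn.le) two_ne_zero).1 h2

/-! ## §7 ★★★ The exact commutator ball -/

/-- The commutator ball is measurable. [folklore] -/
theorem measurableSet_commBall (z : ℍ) (t : ℝ) :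
    MeasurableSet {u : Matrix.specialUnitaryGroup (Fin 2) ℂ | ‖z * su2Quat u - su2Quat u * z‖ ≤ t} :=
  measurableSet_le ((continuous_const.mul continuous_su2Quat).sub (continuous_su2Quat.mul continuous_const)).norm.measurable
    measurable_const

/-- ★★★ **EXACT ONE-LETTER COMMUTATOR BALL**: for `a ∈ SU(2)` with `re(q a)² < 1` and `t ≥ 0`,
`Haar{u | ‖q a·q u − q u·q a‖ ≤ t} = min 1 (t²/(4(1 − re(q a)²)))` (as an extended real). [folklore] -/
theorem haar_commBall_eq_ofReal (a : Matrix.specialUnitaryGroup (Fin 2) ℂ) (ha : (su2Quat a).re ^ 2 < 1) {t : ℝ} (ht : 0 ≤ t) :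
    haarProbability (Matrix.specialUnitaryGroup (Fin 2) ℂ)
        {u : Matrix.specialUnitaryGroup (Fin 2) ℂ | ‖su2Quat a * su2Quat u - su2Quat u * su2Quat a‖ ≤ t} =
      ENNReal.ofReal (min 1 (t ^ 2 / (4 * (1 - (su2Quat a).re ^ 2)))) := by
  set z := su2Quat a with hz
  -- `‖Im z‖² = 1 − re² > 0`
  have hs2 : ‖z.im‖ ^ 2 = 1 - z.re ^ 2 := by rw [sq_norm_im_eq, hz, norm_su2Quat, one_pow]
  have hs : 0 < ‖z.im‖ := by
    have h1 : 0 < ‖z.im‖ ^ 2 := by rw [hs2]; linarith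
    nlinarith [norm_nonneg z.im, h1]
  have him : z.im ≠ 0 := norm_pos_iff.1 hs
  obtain ⟨c, hc, hstr⟩ := exists_unit_straighten him
  set R : ℝ := t / (2 * ‖z.im‖) with hR
  have hR0 : 0 ≤ R := by positivity
  have hR2 : R ^ 2 = t ^ 2 / (4 * (1 - z.re ^ 2)) := by
    rw [hR, ← hs2, div_pow, mul_pow]; norm_num
  -- both events in the cone model
  have hE := haar_eq_cone_preimage (measurableSet_commBall z t)
  have hT := haar_eq_cone_preimage (measurableSet_tube R)
  rw [hE, ← hR2, ← haar_axialTube_eq_ofReal hR0, hT,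
    ← (measurePreserving_conjIso_cone c hc).measure_preimage (measurable_quatToSU2 (measurableSet_tube R)).nullMeasurableSet]
  -- the two preimages agree off the null point `0`
  refine measure_congr (ae_ne_zero_cone.mono fun x hx => ?_)
  exact propext (mem_commBall_iff hc hstr hs ht hx)

/-- ★★★ **EXACT ONE-LETTER COMMUTATOR BALL, real form** (the shape Z1 of the plan): for `a ∈ SU(2)` with `re(q a)² < 1` and `t ≥ 0`,
`Haar.real{u | ‖q a·q u − q u·q a‖ ≤ t} = min 1 (t²/(4(1 − re(q a)²)))`. [folklore] -/
theorem haar_commBall_eq (a : Matrix.specialUnitaryGroup (Fin 2) ℂ) (ha : (su2Quat a).re ^ 2 < 1) {t : ℝ} (ht : 0 ≤ t) :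
    (haarProbability (Matrix.specialUnitaryGroup (Fin 2) ℂ)).real
        {u : Matrix.specialUnitaryGroup (Fin 2) ℂ | ‖su2Quat a * su2Quat u - su2Quat u * su2Quat a‖ ≤ t} =
      min 1 (t ^ 2 / (4 * (1 - (su2Quat a).re ^ 2))) := by
  rw [measureReal_def, haar_commBall_eq_ofReal a ha ht, ENNReal.toReal_ofReal (le_min zero_le_one (by
    have : 0 < 1 - (su2Quat a).re ^ 2 := by linarith
    positivity))]

/-- The UNSATURATED regime (`t² ≤ 4(1 − re(q a)²)`): the commutator ball is exactly quadratic, `Haar = t²/(4(1 − re(q a)²))`. [folklore] -/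
theorem haar_commBall_eq_of_le (a : Matrix.specialUnitaryGroup (Fin 2) ℂ) (ha : (su2Quat a).re ^ 2 < 1) {t : ℝ} (ht : 0 ≤ t)
    (hsmall : t ^ 2 ≤ 4 * (1 - (su2Quat a).re ^ 2)) :
    (haarProbability (Matrix.specialUnitaryGroup (Fin 2) ℂ)).real
        {u : Matrix.specialUnitaryGroup (Fin 2) ℂ | ‖su2Quat a * su2Quat u - su2Quat u * su2Quat a‖ ≤ t} =
      t ^ 2 / (4 * (1 - (su2Quat a).re ^ 2)) := by
  rw [haar_commBall_eq a ha ht, min_eq_right]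
  have : 0 < 4 * (1 - (su2Quat a).re ^ 2) := by linarith
  rwa [div_le_one this]

/-- Central letters: if `re(q a)² = 1` the commutator vanishes identically and the ball is everything. [folklore] -/
theorem haar_commBall_eq_one_of_central (a : Matrix.specialUnitaryGroup (Fin 2) ℂ) (ha : (su2Quat a).re ^ 2 = 1) {t : ℝ} (ht : 0 ≤ t) :
    (haarProbability (Matrix.specialUnitaryGroup (Fin 2) ℂ)).real
        {u : Matrix.specialUnitaryGroup (Fin 2) ℂ | ‖su2Quat a * su2Quat u - su2Quat u * su2Quat a‖ ≤ t} = 1 := by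
  have him : (su2Quat a).im = 0 := by
    have h := sq_norm_im_eq (su2Quat a)
    rw [norm_su2Quat, one_pow, ha, sub_self] at h
    exact norm_eq_zero.1 (pow_eq_zero_iff two_ne_zero |>.1 h)
  have hall : {u : Matrix.specialUnitaryGroup (Fin 2) ℂ | ‖su2Quat a * su2Quat u - su2Quat u * su2Quat a‖ ≤ t} = Set.univ := by
    refine Set.eq_univ_of_forall fun u => ?_
    rw [Set.mem_setOf_eq]
    have hcomm : su2Quat a * su2Quat u - su2Quat u * su2Quat a = 0 := by
      have hre : su2Quat a = ((su2Quat a).re : ℍ) := by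
        rw [← Quaternion.re_add_im (su2Quat a), him, add_zero]; simp
      rw [hre, Quaternion.coe_mul_eq_smul, ← Quaternion.coe_mul_eq_smul, sub_eq_zero]
      ext <;> simp [mul_comm]
    rw [hcomm, norm_zero]; exact ht
  rw [hall, measureReal_def, measure_univ, ENNReal.toReal_one]

end Summit.QuantumFields.YangMills.Theorems.SwapVirialDeficit.ZeroModeExact

end
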